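import Mathlib
import Literature.MathematicalPhysics.QuantumLattice.HubbardBandSectorCountingToolbox
import Literature.MathematicalPhysics.QuantumLattice.HubbardFermiBandCurvature
import HarnessLib

/-!
# Four-sector counting, fold ranges: the diagonal function at the FORWARD point — `D(θ₁+π) = D′(θ₁+π) = 0` and `D(σ) ≥ h_min·(σ − θ₁ − π)²`

Topic `Literature/MathematicalPhysics/QuantumLattice`; sub-namespace `BandSectorCounting` (continues `HubbardBandSectorCountingToolbox`).
Part (F3d′) of the log-free ANISOTROPIC anchored four-sector counting lemma («E1-P2-THIN-COUNT», cell gate-hubbard-kl, plan g17 (R41); seat p4; plan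
HOME/prover-p4/E1-P2-THIN-COUNT-PLAN.md §Refinement 4).  The thin fold tolerance is `δ_σ ≍ w² + w·|σ − θ₁ − π|` (`ThinSectorFoldTolerance`); the per-row
fold count is `≍ δ_σ/(w√D(σ))` (`gridCount_L5(_affine)`), `D(σ) = h(θ₁; σ, σ)` the diagonal function.  At the FORWARD point `σ = θ₁ + π` (momentum sum
`p₁ + 2p(θ₁+π) = −p₁`, on the curve) `D` has a nondegenerate minimum with value `0`: `D(θ₁+π) = 0` (`ε` even), `D′(θ₁+π) = 4(sin x₁·x₁′ + sin y₁·y₁′) = 0`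
(the velocity is tangent to the level curve, `sin_mul_bandVX_add`), and `D″ ≥ 2h_min` on the stratum `{|D| ≤ η₀, |D′| ≤ η₁}` (`diag_strat`), which contains the window
`|σ − θ₁ − π| ≤ m₁` as soon as `(16s_max² + 8A₂)·m₁ ≤ η₁`, `(16s_max² + 8A₂)·m₁² ≤ η₀`.  Hence **`diag_ge_sq_forward`**: `h_min·(σ − θ₁ − π)² ≤ D(σ)` there
— so on the forward rows `δ_σ/√D(σ) ≤ C₀w²/(√h_min·|m|) + 2K₃w/√h_min`: `O(1)` cells per row plus an additive harmonic `O(log N)`, no multiplicative log.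

Everything is PROVED; no definitions, no named facts.

## Sources

* G. Benfatto, A. Giuliani, V. Mastropietro, Ann. Henri Poincaré 7 (2006) 809–898, Lemma 3.1, App. A2. [BenfattoGiulianiMastropietro2006]
* V. Mastropietro, *Non-Perturbative Renormalization* (World Scientific, 2008), ch. 14, (14.67) p. 223; p. 229. [Mastropietro2008]
-/

noncomputable section

open Real Set
open Literature.MathematicalPhysics.QuantumLattice

namespace Literature.MathematicalPhysics.QuantumLattice.BandSectorCounting

/-- Two-sided segment mean-value inequality (private plumbing). [folklore] -/
private theorem abs_sub_le_mul_abs_of_deriv {f f' : ℝ → ℝ} {C a b : ℝ} (hf : ∀ t, HasDerivAt f (f' t) t)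
    (hC : ∀ t ∈ uIcc a b, |f' t| ≤ C) : |f b - f a| ≤ C * |b - a| := by
  have h := Convex.norm_image_sub_le_of_norm_hasDerivWithin_le (fun t _ => (hf t).hasDerivWithinAt)
    (fun t ht => by rw [Real.norm_eq_abs]; exact hC t ht) (convex_uIcc a b) left_mem_uIcc right_mem_uIcc
  simpa [Real.norm_eq_abs] using h

section Level

variable {μ : ℝ} (hμ₁ : -4 < μ) (hμ₂ : μ < 0)
include hμ₁ hμ₂

/-- **The forward point is a zero of the diagonal function**: `h(θ₁; θ₁+π, θ₁+π) = ε(−p₁) − μ = 0`.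
[cite: BenfattoGiulianiMastropietro2006, App. A2] -/
theorem hfun_diag_forward (θ₁ : ℝ) : hfun μ θ₁ (θ₁ + π) (θ₁ + π) = 0 := by
  obtain ⟨hx, hy, -, -⟩ := band_add_pi hμ₁ hμ₂ θ₁
  unfold hfun SX SY
  rw [hx, hy, show bandX μ θ₁ + -bandX μ θ₁ + -bandX μ θ₁ = -bandX μ θ₁ by ring,
    show bandY μ θ₁ + -bandY μ θ₁ + -bandY μ θ₁ = -bandY μ θ₁ by ring, eps2_neg, eps2_bandXY hμ₁ hμ₂, sub_self]

/-- **The forward point is a critical point of the diagonal function**: `D′(θ₁+π) = 4(sin S_x·x′ + sin S_y·y′)(θ₁+π) = 0`.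
[cite: BenfattoGiulianiMastropietro2006, App. A2] -/
theorem diag_deriv_forward (θ₁ : ℝ) :
    4 * (Real.sin (SX μ θ₁ (θ₁ + π) (θ₁ + π)) * bandVX μ (θ₁ + π) + Real.sin (SY μ θ₁ (θ₁ + π) (θ₁ + π)) * bandVY μ (θ₁ + π)) = 0 := by
  obtain ⟨hx, hy, hvx, hvy⟩ := band_add_pi hμ₁ hμ₂ θ₁
  unfold SX SY
  rw [hx, hy, hvx, hvy, show bandX μ θ₁ + -bandX μ θ₁ + -bandX μ θ₁ = -bandX μ θ₁ by ring,
    show bandY μ θ₁ + -bandY μ θ₁ + -bandY μ θ₁ = -bandY μ θ₁ by ring, Real.sin_neg, Real.sin_neg]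
  have := sin_mul_bandVX_add hμ₁ hμ₂ θ₁
  linear_combination (4 : ℝ) * this

end Level

section Band

variable {a b : ℝ} (B : BandBounds a b) {μ : ℝ} (hμ : μ ∈ Icc a b)
include B hμ

/-- **Quadratic growth of the diagonal function at the forward point**: if `|σ − θ₁ − π| ≤ m₁` with `(16s_max² + 8A₂)·m₁ ≤ η₁`,
`(16s_max² + 8A₂)·m₁² ≤ η₀` and the smallness of `diag_strat`, then `h_min·(σ − θ₁ − π)² ≤ h(θ₁; σ, σ)`.
[cite: BenfattoGiulianiMastropietro2006, Lemma 3.1 / App. A2] -/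
theorem diag_ge_sq_forward {θ₁ σ η₀ η₁ m₁ : ℝ} (hlo : a ≤ μ - η₀) (hhi : μ + η₀ ≤ b)
    (hsmall : (16 * B.smax ^ 2 + 8 * B.A2) * (η₀ / B.Dtmin + B.smax * (B.Cg * (η₁ / 4 + 2 * B.smax * (η₀ / B.Dtmin)))) ≤ 2 * B.hmin)
    (hm : |σ - θ₁ - π| ≤ m₁) (hm₁ : (16 * B.smax ^ 2 + 8 * B.A2) * m₁ ≤ η₁) (hm₁' : (16 * B.smax ^ 2 + 8 * B.A2) * m₁ ^ 2 ≤ η₀) :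
    B.hmin * (σ - θ₁ - π) ^ 2 ≤ hfun μ θ₁ σ σ := by
  obtain ⟨h1, h2⟩ := B.level hμ
  have hs := B.smax_pos; have hA := B.A2_pos
  set x₀ := θ₁ + π with hx₀
  set AD := 16 * B.smax ^ 2 + 8 * B.A2 with hAD
  have hAD0 : 0 < AD := by positivity
  have hm0 : 0 ≤ m₁ := (abs_nonneg _).trans hm
  -- the diagonal function and its two derivatives
  set g : ℝ → ℝ := fun x => hfun μ θ₁ x x with hg
  set g1 : ℝ → ℝ := fun x => 4 * (Real.sin (SX μ θ₁ x x) * bandVX μ x + Real.sin (SY μ θ₁ x x) * bandVY μ x) with hg1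
  set g2 : ℝ → ℝ := fun x => 8 * (Real.cos (SX μ θ₁ x x) * bandVX μ x ^ 2 + Real.cos (SY μ θ₁ x x) * bandVY μ x ^ 2) +
      4 * (Real.sin (SX μ θ₁ x x) * bandAX μ x + Real.sin (SY μ θ₁ x x) * bandAY μ x) with hg2
  have hgd : ∀ x, HasDerivAt g (g1 x) x := hasDerivAt_hfun_diag_zero h1 h2 θ₁
  have hg1d : ∀ x, HasDerivAt g1 (g2 x) x := hasDerivAt_hfun_diag_zero_deriv h1 h2 θ₁
  have hg0 : g x₀ = 0 := hfun_diag_forward h1 h2 θ₁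
  have hg10 : g1 x₀ = 0 := diag_deriv_forward h1 h2 θ₁
  have hg2bd : ∀ x, |g2 x| ≤ AD := fun x => abs_diag_deriv2_le B hμ θ₁ x
  have hσ : |σ - x₀| ≤ m₁ := by rw [hx₀, show σ - (θ₁ + π) = σ - θ₁ - π by ring]; exact hm
  -- on the segment: `|g1| ≤ AD·m₁ ≤ η₁`, `|g| ≤ AD·m₁² ≤ η₀`, hence `g2 ≥ 2 h_min`
  have hseg : ∀ z ∈ uIcc x₀ σ, |z - x₀| ≤ m₁ := fun z hz => (abs_sub_left_of_mem_uIcc hz).trans hσ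
  have hg1z : ∀ z ∈ uIcc x₀ σ, |g1 z| ≤ AD * m₁ := by
    intro z hz
    have := abs_sub_le_mul_abs_of_deriv hg1d (a := x₀) (b := z) (fun t ht => hg2bd t)
    rw [hg10, sub_zero] at this
    exact this.trans (mul_le_mul_of_nonneg_left (hseg z hz) hAD0.le)
  have hgz : ∀ z ∈ uIcc x₀ σ, |g z| ≤ AD * m₁ ^ 2 := by
    intro z hz
    have hsub : uIcc x₀ z ⊆ uIcc x₀ σ := uIcc_subset_uIcc_left hz
    have := abs_sub_le_mul_abs_of_deriv hgd (a := x₀) (b := z) (fun t ht => hg1z t (hsub ht))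
    rw [hg0, sub_zero] at this
    calc |g z| ≤ AD * m₁ * |z - x₀| := this
      _ ≤ AD * m₁ * m₁ := mul_le_mul_of_nonneg_left (hseg z hz) (by positivity)
      _ = AD * m₁ ^ 2 := by ring
  have hstrat : ∀ z ∈ uIcc x₀ σ, 2 * B.hmin ≤ g2 z := by
    intro z hz
    exact diag_strat B hμ hlo hhi ((hgz z hz).trans hm₁') ((hg1z z hz).trans hm₁) hsmall
  -- quadratic lower bound from `x₀`
  rcases le_total x₀ σ with hle | hle
  · have := quadratic_lower_right hgd hg1d hle (c₂ := 2 * B.hmin) (fun z hz => hstrat z (by rw [uIcc_of_le hle]; exact hz))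
    rw [hg0, hg10, zero_mul, zero_add, zero_add] at this
    rw [show σ - θ₁ - π = σ - x₀ by rw [hx₀]; ring]
    linarith
  · have := quadratic_lower_left hgd hg1d hle (c₂ := 2 * B.hmin) (fun z hz => hstrat z (by rw [uIcc_of_ge hle]; exact hz))
    rw [hg0, hg10, zero_mul, zero_add, zero_add] at this
    rw [show σ - θ₁ - π = σ - x₀ by rw [hx₀]; ring]
    linarith

end Band

end Literature.MathematicalPhysics.QuantumLattice.BandSectorCounting

end
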